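import Summits.AtomisticToContinuum.HydrodynamicLimit.Theorems.LambertianContactSwapLambertianWellPosedJInv
import Summits.AtomisticToContinuum.HydrodynamicLimit.Theorems.LambertianContactSwapLambertianWellPosedWindow

/-!
# Noise masses and the modified short-time pieces

Helper file (`--supports`) of the support item `LambertianWellPosed` of route `LambertianContactSwap`
(`AtomisticToContinuum/HydrodynamicLimit`, stmt-AtomisticToContinuum-12101).
Preparations for the one-window estimate of the Lambertian recursion: the noise mass of the fibres of a
measurable set of (datum, noise) pairs is measurable, the modified short-time pieces (hit pieces at
interaction length `2Vδ`) are measurable, pairwise disjoint and contained in the short-time good set at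
length `2Vδ`, and the deterministic one-window estimate transfers to noise masses.
-/

noncomputable section

open MeasureTheory ProbabilityTheory Set Function Filter Metric
open scoped ENNReal InnerProductSpace Real

namespace Summit.AtomisticToContinuum.HydrodynamicLimit.Theorems

open Literature.MathematicalPhysics.KineticTheory Literature.Analysis.FluidPDE
  Literature.Analysis.FluidPDE.Alexander

open LWindow

namespace HalfAngle

/-! ## The Lambertian flow over a short window does not lose measure -/

section WindowMeasure

variable {N : ℕ} {ε r δ V : ℝ}

/-- Sections of a product set along the second factor are measurable functions of the first coordinate,
composed with a measurable map (the noise mass of a fibre of `B`). [folklore] -/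
theorem measurable_noiseMass {B : Set (Config N (Fin 3) (UnitAddTorus (Fin 3)) × (ℕ → EuclideanSpace ℝ (Fin 3)))}
    (hB : MeasurableSet B) :
    Measurable fun y : Config N (Fin 3) (UnitAddTorus (Fin 3)) => lambertNoise (Fin 3) (Prod.mk y ⁻¹' B) :=
  measurable_measure_prodMk_left hB

/-- The modified pieces: the far set and the no-hit pieces of interaction length `r`, and the hit pieces of
interaction length `2Vδ`; pairwise disjoint and contained in `shortGood N ε (2Vδ) δ` when `2Vδ ≤ r`.
[folklore] -/
theorem modPiece_disjoint_subset (hε : 0 < ε) (hεr : ε + 2 * r < 2⁻¹) (hr4 : 4 * V * δ ≤ r) (hV0 : 0 ≤ V)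
    (hδ : 0 ≤ δ) :
    let P : Option ((Fin N × Fin N) × Bool) → Set (Config N (Fin 3) (UnitAddTorus (Fin 3))) := fun ι =>
      ι.elim (farSet N ε r) (fun pb => if pb.1.1 < pb.1.2 then
        (if pb.2 = true then hitPiece N ε (2 * V * δ) δ pb.1.1 pb.1.2 else noHitPiece N ε r δ pb.1.1 pb.1.2) else ∅)
    (∀ ι, MeasurableSet (P ι)) ∧
    (∀ ι κ (z : Config N (Fin 3) (UnitAddTorus (Fin 3))), configEnergy z ≤ V ^ 2 / 2 → z ∈ P ι → z ∈ P κ → ι = κ) ∧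
    (∀ ι, P ι ⊆ shortGood N ε (2 * V * δ) δ) := by
  intro P
  have hVδ : 0 ≤ 2 * V * δ := by positivity
  have hrr : 2 * V * δ ≤ r := by nlinarith
  have hr0 : 0 ≤ r := hVδ.trans hrr
  have hr' : 2 * V * δ ≤ 2 * V * δ := le_rfl
  have hεr' : ε + 2 * (2 * V * δ) < 2⁻¹ := by linarith
  -- no-collision data are in no hit piece of length `2Vδ`
  have free_not_hit : ∀ {z : Config N (Fin 3) (UnitAddTorus (Fin 3))}, configEnergy z ≤ V ^ 2 / 2 →
      (∀ t ∈ Icc (0 : ℝ) δ, ∀ k l : Fin N, k ≠ l → ε < ‖(Torus.geometry (Fin 3)).sepVec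
        (freeFlight (Torus.geometry (Fin 3)) t z k).1 (freeFlight (Torus.geometry (Fin 3)) t z l).1‖) →
      ∀ {p : Fin N × Fin N}, p.1 < p.2 → z ∉ hitPiece N ε (2 * V * δ) δ p.1 p.2 := by
    intro z hE H p hp hz
    have hh : HitHyp ε (2 * V * δ) δ V z p.1 p.2 := ⟨hε, hεr', hr', hV0, hE, hp, hz⟩
    have hc := hh.freeFlight_hitTime_mem_contactSet
    exact (H _ ⟨hh.hitTime_pos.le, hh.hitTime_le⟩ p.1 p.2 hh.ne).ne' hc.2
  have far_H : ∀ {z : Config N (Fin 3) (UnitAddTorus (Fin 3))}, configEnergy z ≤ V ^ 2 / 2 → z ∈ farSet N ε r →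
      ∀ t ∈ Icc (0 : ℝ) δ, ∀ k l : Fin N, k ≠ l → ε < ‖(Torus.geometry (Fin 3)).sepVec
        (freeFlight (Torus.geometry (Fin 3)) t z k).1 (freeFlight (Torus.geometry (Fin 3)) t z l).1‖ :=
    fun hE hz => forall_lt_norm_of_mem_farSet (norm_vel_le_of_configEnergy_le hV0 hE) hrr hz
  have noHit_H : ∀ {z : Config N (Fin 3) (UnitAddTorus (Fin 3))} {p : Fin N × Fin N}, configEnergy z ≤ V ^ 2 / 2 →
      z ∈ noHitPiece N ε r δ p.1 p.2 →
      ∀ t ∈ Icc (0 : ℝ) δ, ∀ k l : Fin N, k ≠ l → ε < ‖(Torus.geometry (Fin 3)).sepVec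
        (freeFlight (Torus.geometry (Fin 3)) t z k).1 (freeFlight (Torus.geometry (Fin 3)) t z l).1‖ :=
    fun hE hz => forall_lt_norm_of_mem_noHitPiece hε (norm_vel_le_of_configEnergy_le hV0 hE) hrr hεr hz
  refine ⟨fun ι => ?_, fun ι κ z hE hι hκ => ?_, fun ι z hz => ?_⟩
  · rcases ι with _ | ⟨p, b⟩
    · exact measurableSet_farSet ε r
    · show MeasurableSet (if p.1 < p.2 then
        (if b = true then hitPiece N ε (2 * V * δ) δ p.1 p.2 else noHitPiece N ε r δ p.1 p.2) else ∅)
      split_ifs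
      · exact measurableSet_hitPiece ε _ δ p.1 p.2
      · exact measurableSet_noHitPiece ε r δ p.1 p.2
      · exact MeasurableSet.empty
  · -- unpack
    have unpack : ∀ {κ : Option ((Fin N × Fin N) × Bool)}, z ∈ P κ →
        κ = none ∧ z ∈ farSet N ε r ∨ ∃ p : Fin N × Fin N, p.1 < p.2 ∧
          (κ = some (p, false) ∧ z ∈ noHitPiece N ε r δ p.1 p.2 ∨
            κ = some (p, true) ∧ z ∈ hitPiece N ε (2 * V * δ) δ p.1 p.2) := by
      intro κ hz
      rcases κ with _ | ⟨p, b⟩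
      · exact Or.inl ⟨rfl, hz⟩
      · change z ∈ (if p.1 < p.2 then
          (if b = true then hitPiece N ε (2 * V * δ) δ p.1 p.2 else noHitPiece N ε r δ p.1 p.2) else ∅) at hz
        split_ifs at hz with hp hb
        · cases b
          · exact absurd hb Bool.false_ne_true
          · exact Or.inr ⟨p, hp, Or.inr ⟨rfl, hz⟩⟩
        · cases b
          · exact Or.inr ⟨p, hp, Or.inl ⟨rfl, hz⟩⟩
          · exact absurd rfl hb
        · exact absurd hz (notMem_empty z)
    have far_noHit : ∀ {p : Fin N × Fin N}, p.1 < p.2 → z ∈ farSet N ε r → z ∉ noHitPiece N ε r δ p.1 p.2 :=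
      fun hp hf hn => (not_le.2 (hf _ _ hp.ne)) hn.2.2.1
    have noHit_noHit : ∀ {p p' : Fin N × Fin N}, p.1 < p.2 → p'.1 < p'.2 →
        z ∈ noHitPiece N ε r δ p.1 p.2 → z ∈ noHitPiece N ε r δ p'.1 p'.2 → p = p' := by
      intro p p' hp hp' hn hn'
      by_cases hpp : ({p'.1, p'.2} : Finset (Fin N)) = {p.1, p.2}
      · obtain ⟨h1, h2⟩ := eq_of_pair_eq_of_lt hp hp' hpp
        exact (Prod.ext h1 h2).symm
      · exact absurd hn'.2.2.1 (not_le.2 (hn.1 _ _ hp'.ne hpp))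
    rcases unpack hι with ⟨rfl, hf⟩ | ⟨p, hp, ⟨rfl, hn⟩ | ⟨rfl, hh⟩⟩ <;>
      rcases unpack hκ with ⟨rfl, hf'⟩ | ⟨p', hp', ⟨rfl, hn'⟩ | ⟨rfl, hh'⟩⟩
    · rfl
    · exact absurd hn' (far_noHit hp' hf)
    · exact absurd hh' (free_not_hit hE (far_H hE hf) hp')
    · exact absurd hn (far_noHit hp hf')
    · rw [noHit_noHit hp hp' hn hn']
    · exact absurd hh' (free_not_hit hE (noHit_H hE hn) hp')
    · exact absurd hh (free_not_hit hE (far_H hE hf') hp)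
    · exact absurd hh (free_not_hit hE (noHit_H hE hn') hp)
    · obtain ⟨h1, h2⟩ := eq_of_mem_hitPiece_of_mem_hitPiece hp hp' hh hh'
      rw [show p' = p from Prod.ext h1 h2]
  · rcases ι with _ | ⟨p, b⟩
    · exact mem_shortGood.2 (Or.inl fun k l hkl => by linarith [hz k l hkl])
    · change z ∈ (if p.1 < p.2 then
        (if b = true then hitPiece N ε (2 * V * δ) δ p.1 p.2 else noHitPiece N ε r δ p.1 p.2) else ∅) at hz
      split_ifs at hz with hp hb
      · exact mem_shortGood.2 (Or.inr ⟨p, hp, Or.inr hz⟩)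
      · obtain ⟨ho, hq, hq', hnh⟩ := hz
        by_cases hclose : ‖(Torus.geometry (Fin 3)).sepVec (z p.1).1 (z p.2).1‖ ≤ ε + 2 * V * δ
        · exact mem_shortGood.2 (Or.inr ⟨p, hp, Or.inl ⟨fun k l hkl hne => by linarith [ho k l hkl hne], hq, hclose, hnh⟩⟩)
        · refine mem_shortGood.2 (Or.inl fun k l hkl => ?_)
          by_cases hne : ({k, l} : Finset (Fin N)) = {p.1, p.2}
          · rcases finsetPair_eq_iff.1 hne with ⟨rfl, rfl⟩ | ⟨rfl, rfl⟩
            · exact not_le.1 hclose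
            · rw [norm_sepVec_comm]; exact not_le.1 hclose
          · linarith [ho k l hkl hne]
      · exact absurd hz (notMem_empty z)

end WindowMeasure

end HalfAngle

end Summit.AtomisticToContinuum.HydrodynamicLimit.Theorems
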